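import Literature.Barriers.NavierStokesRegularity.NavierStokesInequalityGluing
import Literature.Analysis.FluidPDE.SmoothLocalEnergy
import HarnessLib

/-!
# Gluing weak solutions of the Navier–Stokes inequality along a sequence of switching times, II

Sequel of `NavierStokesInequalityGluing.lean` (same setting and references): the **local energy
inequality of the glued field**. If a field `𝔲` on `(0,∞) × E` agrees on each piece
`[t_j, t_{j+1})` of a partition `0 = t₀ < t₁ < ⋯ ↑ T₀` with fields `v_j` (pressure `q_j`,
gradient `Dv_j`) satisfying the local energy inequality WITH BOUNDARY TERMS on `[t_j, t_{j+1}]`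
(Ożański 2017, (1.6); for classical NSI solutions this is the tree's `nsi_localEnergyIneq_Icc`),
vanishes from `T₀` on, the magnitudes DROP at the switching times,
`|v_{j+1}(t_{j+1}, x)| ≤ |v_j(t_{j+1}, x)|` (Ożański 2017, (2.6); Scheffer 1985, (2.33)), and the
energy-class quantities `|𝔲|², |𝔲|³, |p||𝔲|, |∇𝔲|²` are integrable on `(0,∞) × E` (Ożański's
"global-in-time integrability of all the terms", Scheffer's (2.34)), then `𝔲` satisfies the
local energy inequality of `IsWeakNSISolution` for every nonnegative test function on
`(0,∞) × E`: summing the piecewise inequalities, the boundary terms telescope with the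
favourable sign and the partial sums converge (`localEnergyIneq_of_piecewise`).

The second theorem `isWeakNSISolution_of_piecewise` assembles the four conjuncts of
`IsWeakNSISolution` from the piecewise data (weak divergence and weak gradient from part I, the
energy bound and the slice-wise pressure class as hypotheses).

## References

* W. S. Ożański, arXiv:1709.00602 (2017), §1 (1.6) and after, §2 pp. 6–7 ((2.6), "the
  Dominated Convergence Theorem lets us take the limit `S' → T₀`"). [`Ozanski2017NSISingular`]
* V. Scheffer, Comm. Math. Phys. 101 (1985), proof of Lemma 2.3, (2.32)–(2.34). [`Scheffer1985`]
* W. S. Ożański, Comm. Math. Phys. 374 (2020), Def. 1.1. [`Ozanski2019NSI`]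
-/

noncomputable section

open MeasureTheory Set Function Filter Topology TopologicalSpace Metric
open scoped ENNReal InnerProductSpace RealInnerProductSpace ContDiff Laplacian

namespace Literature.Barriers.NavierStokesRegularity

open Literature.Analysis.FluidPDE

variable {E : Type*} [NormedAddCommGroup E] [InnerProductSpace ℝ E] [FiniteDimensional ℝ E]
  [MeasurableSpace E] [BorelSpace E]

/-! ### Bounds for test functions and their derivatives -/

section TestBounds

/-- A continuous function vanishing off a compact set is bounded. [folklore] -/
theorem exists_bound_of_continuous_of_eq_zero {X F : Type*} [TopologicalSpace X]
    [NormedAddCommGroup F] {f : X → F} {K : Set X} (hK : IsCompact K) (hf : Continuous f)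
    (h0 : ∀ z ∉ K, f z = 0) : ∃ C, 0 ≤ C ∧ ∀ z, ‖f z‖ ≤ C := by
  obtain ⟨C, hC⟩ := hK.exists_bound_of_continuousOn hf.continuousOn
  refine ⟨max C 0, le_max_right _ _, fun z => ?_⟩
  by_cases hz : z ∈ K
  · exact (hC z hz).trans (le_max_left _ _)
  · rw [h0 z hz, norm_zero]; exact le_max_right _ _

variable {φ : ℝ → E → ℝ} {Q : Opens (ℝ × E)}

omit [MeasurableSpace E] [BorelSpace E] in
/-- **Uniform bounds for a space–time test function and the derivatives entering the local
energy inequality**: `|φ|, |∂ₜφ|, |Δφ|, |∇φ| ≤ C`. [folklore] -/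
theorem exists_bound_test_derivs (hφ : IsSpaceTimeTestOn Q φ) :
    ∃ C, 0 ≤ C ∧ ∀ s x, |φ s x| ≤ C ∧ |timeDeriv φ s x| ≤ C ∧ |Δ (φ s) x| ≤ C ∧
      ‖gradient (φ s) x‖ ≤ C := by
  have hK : IsCompact (tsupport (uncurry φ)) := hφ.hasCompactSupport
  have off : ∀ z : ℝ × E, z ∉ tsupport (uncurry φ) →
      φ z.1 z.2 = 0 ∧ timeDeriv φ z.1 z.2 = 0 ∧ Δ (φ z.1) z.2 = 0 ∧ gradient (φ z.1) z.2 = 0 :=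
    fun z hz => ⟨image_eq_zero_of_notMem_tsupport (f := uncurry φ) hz, timeDeriv_eq_zero_off_tsupport hz,
      laplacian_eq_zero_of_notMem_tsupport (notMem_tsupport_slice_of_notMem hz),
      gradient_eq_zero_of_notMem_tsupport (notMem_tsupport_slice_of_notMem hz)⟩
  obtain ⟨C₁, h₁, hC₁⟩ := exists_bound_of_continuous_of_eq_zero (f := fun z : ℝ × E => φ z.1 z.2)
    hK hφ.contDiff.continuous fun z hz => (off z hz).1
  obtain ⟨C₂, h₂, hC₂⟩ := exists_bound_of_continuous_of_eq_zero
    (f := fun z : ℝ × E => timeDeriv φ z.1 z.2) hK hφ.continuous_timeDeriv fun z hz => (off z hz).2.1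
  obtain ⟨C₃, h₃, hC₃⟩ := exists_bound_of_continuous_of_eq_zero
    (f := fun z : ℝ × E => Δ (φ z.1) z.2) hK hφ.continuous_laplacian_slice fun z hz => (off z hz).2.2.1
  obtain ⟨C₄, h₄, hC₄⟩ := exists_bound_of_continuous_of_eq_zero
    (f := fun z : ℝ × E => gradient (φ z.1) z.2) hK hφ.continuous_slice_gradient
    fun z hz => (off z hz).2.2.2
  refine ⟨C₁ + C₂ + C₃ + C₄, by positivity, fun s x => ⟨?_, ?_, ?_, ?_⟩⟩
  · have := hC₁ (s, x); rw [Real.norm_eq_abs] at this; linarith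
  · have := hC₂ (s, x); rw [Real.norm_eq_abs] at this; linarith
  · have := hC₃ (s, x); rw [Real.norm_eq_abs] at this; linarith
  · have := hC₄ (s, x); linarith

end TestBounds

/-! ### The local energy inequality of the glued field -/

section LEI

variable {t : ℕ → ℝ} {T₀ ν : ℝ} {𝔲 : ℝ → E → E} {p : ℝ → E → ℝ}
  {Gr : ℝ → E → E →L[ℝ] E} {v : ℕ → ℝ → E → E} {q : ℕ → ℝ → E → ℝ}

/-- **Integrability of the dissipation integrand** on all of `ℝ × E` from `|∇𝔲|² ∈ L¹((0,∞) × E)`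
(the test function is bounded and vanishes off `(0,∞) × E`). [folklore] -/
theorem integrable_FD (hmeasG : AEStronglyMeasurable (uncurry Gr)
      (volume.restrict ((slab E (Ioi 0) isOpen_Ioi : Opens (ℝ × E)) : Set (ℝ × E))))
    (hIG : Integrable (fun z : ℝ × E => frobeniusNormSq (Gr z.1 z.2))
      (volume.restrict ((slab E (Ioi 0) isOpen_Ioi : Opens (ℝ × E)) : Set (ℝ × E))))
    {φ : ℝ → E → ℝ} (hφ : IsSpaceTimeTestOn (slab E (Ioi 0) isOpen_Ioi) φ) :
    Integrable (fun z : ℝ × E => frobeniusNormSq (Gr z.1 z.2) * φ z.1 z.2) (volume : Measure (ℝ × E)) := by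
  set FD : ℝ × E → ℝ := fun z => frobeniusNormSq (Gr z.1 z.2) * φ z.1 z.2 with hFDdef
  obtain ⟨C, hC0, hC⟩ := exists_bound_test_derivs hφ
  have hF0 : ∀ z ∉ ((slab E (Ioi 0) isOpen_Ioi : Opens (ℝ × E)) : Set (ℝ × E)), FD z = 0 := fun z hz => by
    simp [hFDdef, hφ.apply_eq_zero (t := z.1) (x := z.2) hz]
  refine IntegrableOn.integrable_of_forall_notMem_eq_zero ?_ hF0
  refine Integrable.mono' (hIG.mul_const C) ?_ (Eventually.of_forall fun z => ?_)
  · have h1 : AEStronglyMeasurable (fun z : ℝ × E => frobeniusNormSq (Gr z.1 z.2))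
        (volume.restrict ((slab E (Ioi 0) isOpen_Ioi : Opens (ℝ × E)) : Set (ℝ × E))) :=
      LerayHopfProofs.continuous_frobeniusNormSq.comp_aestronglyMeasurable hmeasG
    exact h1.mul (hφ.contDiff.continuous.aestronglyMeasurable)
  · rw [hFDdef, norm_mul, Real.norm_of_nonneg (frobeniusNormSq_nonneg _), Real.norm_eq_abs]
    exact mul_le_mul_of_nonneg_left (hC z.1 z.2).1 (frobeniusNormSq_nonneg _)

/-- **Integrability of the right-hand integrand** on all of `ℝ × E` from
`|𝔲|², |𝔲|³, |p||𝔲| ∈ L¹((0,∞) × E)`. [folklore] -/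
theorem integrable_FR
    (hmeas𝔲 : AEStronglyMeasurable (uncurry 𝔲)
      (volume.restrict ((slab E (Ioi 0) isOpen_Ioi : Opens (ℝ × E)) : Set (ℝ × E))))
    (hmeasp : AEStronglyMeasurable (uncurry p)
      (volume.restrict ((slab E (Ioi 0) isOpen_Ioi : Opens (ℝ × E)) : Set (ℝ × E))))
    (hI2 : Integrable (fun z : ℝ × E => ‖𝔲 z.1 z.2‖ ^ 2)
      (volume.restrict ((slab E (Ioi 0) isOpen_Ioi : Opens (ℝ × E)) : Set (ℝ × E))))
    (hI3 : Integrable (fun z : ℝ × E => ‖𝔲 z.1 z.2‖ ^ 3)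
      (volume.restrict ((slab E (Ioi 0) isOpen_Ioi : Opens (ℝ × E)) : Set (ℝ × E))))
    (hIp : Integrable (fun z : ℝ × E => |p z.1 z.2| * ‖𝔲 z.1 z.2‖)
      (volume.restrict ((slab E (Ioi 0) isOpen_Ioi : Opens (ℝ × E)) : Set (ℝ × E))))
    {φ : ℝ → E → ℝ} (hφ : IsSpaceTimeTestOn (slab E (Ioi 0) isOpen_Ioi) φ) :
    Integrable (fun z : ℝ × E => ‖𝔲 z.1 z.2‖ ^ 2 * (timeDeriv φ z.1 z.2 + ν * Δ (φ z.1) z.2) +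
      (‖𝔲 z.1 z.2‖ ^ 2 + 2 * p z.1 z.2) * ⟪𝔲 z.1 z.2, gradient (φ z.1) z.2⟫) (volume : Measure (ℝ × E)) := by
  set FR : ℝ × E → ℝ := fun z => ‖𝔲 z.1 z.2‖ ^ 2 * (timeDeriv φ z.1 z.2 + ν * Δ (φ z.1) z.2) +
      (‖𝔲 z.1 z.2‖ ^ 2 + 2 * p z.1 z.2) * ⟪𝔲 z.1 z.2, gradient (φ z.1) z.2⟫ with hFRdef
  obtain ⟨C, hC0, hC⟩ := exists_bound_test_derivs hφ
  have hF0 : ∀ z ∉ ((slab E (Ioi 0) isOpen_Ioi : Opens (ℝ × E)) : Set (ℝ × E)), FR z = 0 := by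
    rintro ⟨s, x⟩ hz
    have hz' : ((s, x) : ℝ × E) ∉ tsupport (uncurry φ) := fun h => hz (hφ.tsupport_subset h)
    have e1 : timeDeriv φ s x = 0 := timeDeriv_eq_zero_off_tsupport hz'
    have e2 : Δ (φ s) x = 0 :=
      laplacian_eq_zero_of_notMem_tsupport (notMem_tsupport_slice_of_notMem hz')
    have e3 : gradient (φ s) x = 0 :=
      gradient_eq_zero_of_notMem_tsupport (notMem_tsupport_slice_of_notMem hz')
    simp only [hFRdef]
    rw [e1, e2, e3, inner_zero_right]
    ring
  refine IntegrableOn.integrable_of_forall_notMem_eq_zero ?_ hF0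
  set bound : ℝ × E → ℝ := fun z => ‖𝔲 z.1 z.2‖ ^ 2 * (C + |ν| * C) +
    (‖𝔲 z.1 z.2‖ ^ 3 + 2 * (|p z.1 z.2| * ‖𝔲 z.1 z.2‖)) * C with hbound
  have hbint : Integrable bound (volume.restrict ((slab E (Ioi 0) isOpen_Ioi : Opens (ℝ × E)) : Set (ℝ × E))) :=
    (hI2.mul_const _).add ((hI3.add (hIp.const_mul 2)).mul_const C)
  refine Integrable.mono' hbint ?_ (Eventually.of_forall fun z => ?_)
  · have cφt : Continuous fun z : ℝ × E => timeDeriv φ z.1 z.2 := hφ.continuous_timeDeriv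
    have cφg : Continuous fun z : ℝ × E => gradient (φ z.1) z.2 := hφ.continuous_slice_gradient
    have cφL : Continuous fun z : ℝ × E => (Δ (φ z.1)) z.2 := hφ.continuous_laplacian_slice
    have m1 : AEStronglyMeasurable (fun z : ℝ × E => ‖𝔲 z.1 z.2‖ ^ 2)
        (volume.restrict ((slab E (Ioi 0) isOpen_Ioi : Opens (ℝ × E)) : Set (ℝ × E))) := (hmeas𝔲.norm.pow 2)
    have m2 : AEStronglyMeasurable
        (fun z : ℝ × E => ‖𝔲 z.1 z.2‖ ^ 2 * (timeDeriv φ z.1 z.2 + ν * Δ (φ z.1) z.2))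
        (volume.restrict ((slab E (Ioi 0) isOpen_Ioi : Opens (ℝ × E)) : Set (ℝ × E))) :=
      m1.mul ((cφt.add (continuous_const.mul cφL)).aestronglyMeasurable)
    have m3 : AEStronglyMeasurable (fun z : ℝ × E => ‖𝔲 z.1 z.2‖ ^ 2 + 2 * p z.1 z.2)
        (volume.restrict ((slab E (Ioi 0) isOpen_Ioi : Opens (ℝ × E)) : Set (ℝ × E))) :=
      m1.add (hmeasp.const_mul 2)
    have m4 : AEStronglyMeasurable (fun z : ℝ × E => ⟪𝔲 z.1 z.2, gradient (φ z.1) z.2⟫)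
        (volume.restrict ((slab E (Ioi 0) isOpen_Ioi : Opens (ℝ × E)) : Set (ℝ × E))) :=
      hmeas𝔲.inner cφg.aestronglyMeasurable
    exact m2.add (m3.mul m4)
  · obtain ⟨hφb, hTb, hLb, hgb⟩ := hC z.1 z.2
    have hu0 : 0 ≤ ‖𝔲 z.1 z.2‖ := norm_nonneg _
    rw [Real.norm_eq_abs, hFRdef]
    refine (abs_add_le _ _).trans (add_le_add ?_ ?_)
    · rw [abs_mul, abs_of_nonneg (by positivity : (0 : ℝ) ≤ ‖𝔲 z.1 z.2‖ ^ 2)]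
      refine mul_le_mul_of_nonneg_left ((abs_add_le _ _).trans (add_le_add hTb ?_)) (by positivity)
      rw [abs_mul]
      exact mul_le_mul_of_nonneg_left hLb (abs_nonneg _)
    · rw [abs_mul]
      have h1 : |‖𝔲 z.1 z.2‖ ^ 2 + 2 * p z.1 z.2| ≤ ‖𝔲 z.1 z.2‖ ^ 2 + 2 * |p z.1 z.2| := by
        refine (abs_add_le _ _).trans ?_
        rw [abs_of_nonneg (by positivity : (0 : ℝ) ≤ ‖𝔲 z.1 z.2‖ ^ 2), abs_mul, abs_two]
      have h2 : |⟪𝔲 z.1 z.2, gradient (φ z.1) z.2⟫| ≤ ‖𝔲 z.1 z.2‖ * C :=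
        (abs_real_inner_le_norm _ _).trans (mul_le_mul_of_nonneg_left hgb hu0)
      calc |‖𝔲 z.1 z.2‖ ^ 2 + 2 * p z.1 z.2| * |⟪𝔲 z.1 z.2, gradient (φ z.1) z.2⟫|
          ≤ (‖𝔲 z.1 z.2‖ ^ 2 + 2 * |p z.1 z.2|) * (‖𝔲 z.1 z.2‖ * C) :=
            mul_le_mul h1 h2 (abs_nonneg _) (by positivity)
        _ = (‖𝔲 z.1 z.2‖ ^ 3 + 2 * (|p z.1 z.2| * ‖𝔲 z.1 z.2‖)) * C := by ring

/-- Integrals over `(0,∞) × E` of integrands vanishing from `T₀` on and for nonpositive times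
are integrals over `[0, T₀) × E`, hence sums over the strips. [folklore] -/
theorem hasSum_setIntegral_strip (ht : StrictMono t) (h0 : t 0 = 0) (hT : Tendsto t atTop (𝓝 T₀))
    {F : ℝ × E → ℝ} (hF : Integrable F (volume : Measure (ℝ × E)))
    (hF0 : ∀ z : ℝ × E, z.1 ∉ Ico 0 T₀ → F z = 0) :
    HasSum (fun j => ∫ z in Ico (t j) (t (j + 1)) ×ˢ (univ : Set E), F z) (∫ z, F z) := by
  have h := hasSum_integral_iUnion (μ := (volume : Measure (ℝ × E))) (f := F)
    (measurableSet_strip (t := t)) (pairwise_disjoint_strip ht) hF.integrableOn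
  rw [iUnion_strip_eq ht hT, h0] at h
  rwa [setIntegral_eq_integral_of_forall_compl_eq_zero] at h
  exact fun z hz => hF0 z fun h' => hz ⟨h', mem_univ _⟩

/-- Iterated integrals over an open time interval of an integrand integrable on space–time are
integrals over the half-open strip. [folklore] -/
theorem setIntegral_integral_eq_setIntegral_strip {F : ℝ × E → ℝ}
    (hF : Integrable F (volume : Measure (ℝ × E))) (a b : ℝ) :
    ∫ s in Ioo a b, ∫ x, F (s, x) = ∫ z in Ico a b ×ˢ (univ : Set E), F z := by
  have h1 : Integrable F (((volume : Measure ℝ).restrict (Ioo a b)).prod (volume : Measure E)) := by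
    rw [Measure.restrict_prod_eq_prod_univ, ← Measure.volume_eq_prod]
    exact hF.integrableOn
  rw [← setIntegral_prod_univ_eq h1, setIntegral_Ioo_prod_eq_Ico_prod]

/-- **The local energy inequality of the glued field** (Ożański 2017, §2: "the local energy
inequality (1.6) is satisfied on any time interval `[S,S'] ⊂ [0,T₀)` … the Dominated Convergence
Theorem lets us take the limit `S' → T₀`"; Scheffer 1985, (2.32)–(2.34)). Summing the piecewise
inequalities with boundary terms over `j < N`, the boundary terms telescope to
`∫|v_N(t_N)|²φ(t_N) - ∫|v₀(0)|²φ(0) ≥ 0` thanks to the drops `|v_{j+1}(t_{j+1})| ≤ |v_j(t_{j+1})|`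
and `φ(0) = 0`; the remaining sums are partial sums of the integrals over `(0,∞) × E`, which
converge by the global integrability. [cite: Ozanski2017NSISingular, §2 pp. 6–7] -/
theorem localEnergyIneq_of_piecewise (ht : StrictMono t) (h0 : t 0 = 0)
    (hT : Tendsto t atTop (𝓝 T₀))
    (hagree : ∀ j, ∀ s ∈ Ico (t j) (t (j + 1)),
      𝔲 s = v j s ∧ p s = q j s ∧ Gr s = fun x => fderiv ℝ (v j s) x)
    (hzero : ∀ s, T₀ ≤ s → 𝔲 s = 0 ∧ Gr s = 0)
    (hcont : ∀ j, ∀ s ∈ Icc (t j) (t (j + 1)), Continuous (v j s))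
    (hdrop : ∀ j x, ‖v (j + 1) (t (j + 1)) x‖ ≤ ‖v j (t (j + 1)) x‖)
    (hLEI : ∀ j (φ : ℝ → E → ℝ), IsSpaceTimeTestOn (slab E (Ioi 0) isOpen_Ioi) φ → (∀ s x, 0 ≤ φ s x) →
      (∫ x, ‖v j (t (j + 1)) x‖ ^ 2 * φ (t (j + 1)) x) - (∫ x, ‖v j (t j) x‖ ^ 2 * φ (t j) x) +
          2 * ν * ∫ s in Ioo (t j) (t (j + 1)), ∫ x, frobeniusNormSq (fderiv ℝ (v j s) x) * φ s x ≤
        ∫ s in Ioo (t j) (t (j + 1)), ∫ x, (‖v j s x‖ ^ 2 * (timeDeriv φ s x + ν * Δ (φ s) x) +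
          (‖v j s x‖ ^ 2 + 2 * q j s x) * ⟪v j s x, gradient (φ s) x⟫))
    (hmeas𝔲 : AEStronglyMeasurable (uncurry 𝔲)
      (volume.restrict ((slab E (Ioi 0) isOpen_Ioi : Opens (ℝ × E)) : Set (ℝ × E))))
    (hmeasp : AEStronglyMeasurable (uncurry p)
      (volume.restrict ((slab E (Ioi 0) isOpen_Ioi : Opens (ℝ × E)) : Set (ℝ × E))))
    (hmeasG : AEStronglyMeasurable (uncurry Gr)
      (volume.restrict ((slab E (Ioi 0) isOpen_Ioi : Opens (ℝ × E)) : Set (ℝ × E))))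
    (hI2 : Integrable (fun z : ℝ × E => ‖𝔲 z.1 z.2‖ ^ 2)
      (volume.restrict ((slab E (Ioi 0) isOpen_Ioi : Opens (ℝ × E)) : Set (ℝ × E))))
    (hI3 : Integrable (fun z : ℝ × E => ‖𝔲 z.1 z.2‖ ^ 3)
      (volume.restrict ((slab E (Ioi 0) isOpen_Ioi : Opens (ℝ × E)) : Set (ℝ × E))))
    (hIp : Integrable (fun z : ℝ × E => |p z.1 z.2| * ‖𝔲 z.1 z.2‖)
      (volume.restrict ((slab E (Ioi 0) isOpen_Ioi : Opens (ℝ × E)) : Set (ℝ × E))))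
    (hIG : Integrable (fun z : ℝ × E => frobeniusNormSq (Gr z.1 z.2))
      (volume.restrict ((slab E (Ioi 0) isOpen_Ioi : Opens (ℝ × E)) : Set (ℝ × E))))
    {φ : ℝ → E → ℝ} (hφ : IsSpaceTimeTestOn (slab E (Ioi 0) isOpen_Ioi) φ) (hφ0 : ∀ s x, 0 ≤ φ s x) :
    2 * ν * ∫ s, ∫ x, frobeniusNormSq (Gr s x) * φ s x ≤
      ∫ s, ∫ x, (‖𝔲 s x‖ ^ 2 * (timeDeriv φ s x + ν * Δ (φ s) x) +
        (‖𝔲 s x‖ ^ 2 + 2 * p s x) * ⟪𝔲 s x, gradient (φ s) x⟫) := by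
  -- the two space–time integrands, integrable on `ℝ × E`
  set FD : ℝ × E → ℝ := fun z => frobeniusNormSq (Gr z.1 z.2) * φ z.1 z.2 with hFDdef
  set FR : ℝ × E → ℝ := fun z => ‖𝔲 z.1 z.2‖ ^ 2 * (timeDeriv φ z.1 z.2 + ν * Δ (φ z.1) z.2) +
      (‖𝔲 z.1 z.2‖ ^ 2 + 2 * p z.1 z.2) * ⟪𝔲 z.1 z.2, gradient (φ z.1) z.2⟫ with hFRdef
  have hFD : Integrable FD (volume : Measure (ℝ × E)) := integrable_FD hmeasG hIG hφ
  have hFR : Integrable FR (volume : Measure (ℝ × E)) :=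
    integrable_FR (ν := ν) hmeas𝔲 hmeasp hI2 hI3 hIp hφ
  -- they vanish off `[0, T₀) × E`
  have hφle : ∀ s, s ≤ 0 → φ s = 0 := fun s hs => slice_eq_zero_of_nonpos hφ hs
  have hFD0 : ∀ z : ℝ × E, z.1 ∉ Ico 0 T₀ → FD z = 0 := by
    rintro ⟨s, x⟩ hs
    simp only [mem_Ico, not_and, not_lt] at hs
    by_cases hs0 : 0 ≤ s
    · simp [hFDdef, (hzero s (hs hs0)).2, frobeniusNormSq_zero]
    · simp [hFDdef, hφle s (not_le.1 hs0).le]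
  have hFR0 : ∀ z : ℝ × E, z.1 ∉ Ico 0 T₀ → FR z = 0 := by
    rintro ⟨s, x⟩ hs
    simp only [mem_Ico, not_and, not_lt] at hs
    by_cases hs0 : 0 ≤ s
    · simp [hFRdef, (hzero s (hs hs0)).1]
    · have hz' : ((s, x) : ℝ × E) ∉ tsupport (uncurry φ) := fun h => by
        have := hφ.tsupport_subset h
        rw [coe_slab] at this
        exact hs0 (le_of_lt (mem_prod.1 this).1)
      have e1 : timeDeriv φ s x = 0 := timeDeriv_eq_zero_off_tsupport hz'
      have e2 : Δ (φ s) x = 0 :=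
        laplacian_eq_zero_of_notMem_tsupport (notMem_tsupport_slice_of_notMem hz')
      have e3 : gradient (φ s) x = 0 :=
        gradient_eq_zero_of_notMem_tsupport (notMem_tsupport_slice_of_notMem hz')
      simp only [hFRdef]
      rw [e1, e2, e3, inner_zero_right]
      ring
  -- the iterated integrals are the space–time integrals
  have eD : ∫ s, ∫ x, frobeniusNormSq (Gr s x) * φ s x = ∫ z, FD z := by
    rw [Measure.volume_eq_prod, integral_prod _ (by rw [← Measure.volume_eq_prod]; exact hFD)]
  have eR : ∫ s, ∫ x, (‖𝔲 s x‖ ^ 2 * (timeDeriv φ s x + ν * Δ (φ s) x) +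
      (‖𝔲 s x‖ ^ 2 + 2 * p s x) * ⟪𝔲 s x, gradient (φ s) x⟫) = ∫ z, FR z := by
    rw [Measure.volume_eq_prod, integral_prod _ (by rw [← Measure.volume_eq_prod]; exact hFR)]
  rw [eD, eR]
  -- strip sums
  set D : ℕ → ℝ := fun j => ∫ z in Ico (t j) (t (j + 1)) ×ˢ (univ : Set E), FD z with hDdef
  set R : ℕ → ℝ := fun j => ∫ z in Ico (t j) (t (j + 1)) ×ˢ (univ : Set E), FR z with hRdef
  have hDsum : HasSum D (∫ z, FD z) := hasSum_setIntegral_strip ht h0 hT hFD hFD0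
  have hRsum : HasSum R (∫ z, FR z) := hasSum_setIntegral_strip ht h0 hT hFR hFR0
  -- boundary terms
  set A : ℕ → ℝ := fun j => ∫ x, ‖v j (t j) x‖ ^ 2 * φ (t j) x with hAdef
  set B : ℕ → ℝ := fun j => ∫ x, ‖v j (t (j + 1)) x‖ ^ 2 * φ (t (j + 1)) x with hBdef
  have hA0 : A 0 = 0 := by simp [hAdef, h0, hφle 0 le_rfl]
  have hAnonneg : ∀ j, 0 ≤ A j := fun j => integral_nonneg fun x => mul_nonneg (sq_nonneg _) (hφ0 _ _)
  have hdropA : ∀ j, A (j + 1) ≤ B j := by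
    intro j
    have hmem : t (j + 1) ∈ Icc (t j) (t (j + 1)) := right_mem_Icc.2 (ht (Nat.lt_succ_self j)).le
    have hmem' : t (j + 1) ∈ Icc (t (j + 1)) (t (j + 1 + 1)) := left_mem_Icc.2 (ht (Nat.lt_succ_self _)).le
    have hφc : HasCompactSupport (φ (t (j + 1))) := hφ.hasCompactSupport_slice _
    have hφs : Continuous (φ (t (j + 1))) := (hφ.contDiff_slice _).continuous
    have iA : Integrable (fun x => ‖v (j + 1) (t (j + 1)) x‖ ^ 2 * φ (t (j + 1)) x) :=
      (((hcont (j + 1) _ hmem').norm.pow 2).mul hφs).integrable_of_hasCompactSupport hφc.mul_left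
    have iB : Integrable (fun x => ‖v j (t (j + 1)) x‖ ^ 2 * φ (t (j + 1)) x) :=
      (((hcont j _ hmem).norm.pow 2).mul hφs).integrable_of_hasCompactSupport hφc.mul_left
    refine integral_mono iA iB fun x => ?_
    exact mul_le_mul_of_nonneg_right
      (pow_le_pow_left₀ (norm_nonneg _) (hdrop j x) 2) (hφ0 _ _)
  -- the piecewise inequalities in strip form
  have hstep : ∀ j, B j - A j + 2 * ν * D j ≤ R j := by
    intro j
    have h := hLEI j φ hφ hφ0
    have e1 : ∫ s in Ioo (t j) (t (j + 1)), ∫ x, frobeniusNormSq (fderiv ℝ (v j s) x) * φ s x = D j := by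
      simp only [hDdef]
      rw [← setIntegral_integral_eq_setIntegral_strip hFD]
      refine setIntegral_congr_fun measurableSet_Ioo fun s hs => ?_
      have hG := (hagree j s ⟨hs.1.le, hs.2⟩).2.2
      simp only [hFDdef, hG]
    have e2 : ∫ s in Ioo (t j) (t (j + 1)), ∫ x, (‖v j s x‖ ^ 2 * (timeDeriv φ s x + ν * Δ (φ s) x) +
        (‖v j s x‖ ^ 2 + 2 * q j s x) * ⟪v j s x, gradient (φ s) x⟫) = R j := by
      simp only [hRdef]
      rw [← setIntegral_integral_eq_setIntegral_strip hFR]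
      refine setIntegral_congr_fun measurableSet_Ioo fun s hs => ?_
      obtain ⟨hu, hp, -⟩ := hagree j s ⟨hs.1.le, hs.2⟩
      simp only [hFRdef, hu, hp]
    rw [e1, e2] at h
    exact h
  -- telescoping: `2ν Σ_{j<N} D j ≤ Σ_{j<N} R j`
  have hpartial : ∀ N, 2 * ν * ∑ j ∈ Finset.range N, D j ≤ ∑ j ∈ Finset.range N, R j := by
    intro N
    have h1 : ∑ j ∈ Finset.range N, (B j - A j + 2 * ν * D j) ≤ ∑ j ∈ Finset.range N, R j :=
      Finset.sum_le_sum fun j _ => hstep j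
    have h2 : A N - A 0 ≤ ∑ j ∈ Finset.range N, (B j - A j) := by
      rw [← Finset.sum_range_sub A N]
      exact Finset.sum_le_sum fun j _ => sub_le_sub_right (hdropA j) _
    rw [hA0, sub_zero] at h2
    have h3 : ∑ j ∈ Finset.range N, (B j - A j + 2 * ν * D j) =
        ∑ j ∈ Finset.range N, (B j - A j) + 2 * ν * ∑ j ∈ Finset.range N, D j := by
      rw [Finset.mul_sum, ← Finset.sum_add_distrib]
    linarith [hAnonneg N]
  -- pass to the limit
  exact le_of_tendsto_of_tendsto' (hDsum.tendsto_sum_nat.const_mul (2 * ν)) hRsum.tendsto_sum_nat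
    hpartial

end LEI

end Literature.Barriers.NavierStokesRegularity

end
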